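import Mathlib
import Summits.Schanuel.Schanuel.Theorems.RootDecomp1ELevels
import Literature.Barriers.Schanuel.LargeTranscendenceDegree

-- `Summit.Schanuel.Schanuel.…` is the mandated layout of this single-problem summit (CONVENTIONS §1).
set_option linter.dupNamespace false

/-!
# RootDecomp1E, round 11 (lens 2 «LEVELS»), part 3: the SPAN-GRID CEILING (barrier B3 against the layers of `S⁻`)

Supports `stmt-Schanuel-31410` / `stmt-Schanuel-25020`.  PORT of §5 of the lens-2 gen-11 node `Levels.lean`; imports
part 1 (`RootDecomp1ELevels`); same namespace.

On a SPAN-GRID (`x : Fin d → ℂ`, `y : Fin ℓ → ℂ` ℚ-free, all `xᵢyⱼ ∈ span_ℚ z`) of an `n`-tuple: `d, ℓ ≤ n`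
(`grid_rows_le`), so every output of the several-variables method — `[dℓ/(ℓ+d)]`, `[d(ℓ+1)/(ℓ+d)]`, `⌈dℓ/(ℓ+d)⌉`
(`LargeTranscendenceDegree`, Diaz under T.H.) and the conjectural `[dℓ/(ℓ+d)] + 1` (`WaldschmidtConjecture_2_3`,
`n ≥ 5`) — is `≤ n − 2` for `n ≥ 4` (`b3_outputs_le`, `conj23_outputs_le`): inert against
`trdeg_add_two_eq_of_firstFailure`.  At `n = 4` Conjecture 2.3 reaches `3` only on full `(4,4)` grids
(`conj23_t₂_eq_three_only_fullGrid`), which force an irrational algebraic MULTIPLIER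
(`exists_irrational_multiplier_of_fullGrid`, via `isAlgebraic_of_multiplier` = `isIntegral_of_smul_mem_submodule`):
so it is inert on stmt-31410's layer 4 (`conj23_inert_on_plain_four`) and decides, conditionally on the named open
conjecture, exactly the full-grid quadruples (`defectOne_fullGridFour_of_conj23`).  Grids in the exponential module
beyond the span are NOT covered by this numerology (declared in the section docstring).
-/

noncomputable section

namespace Summit.Schanuel.Schanuel.Theorems.RootDecomp1ELevels

open Complex IntermediateField
open Summit.Schanuel.Schanuel.Theses.RootDecomp1E (DefectOneSchanuel EStableDefectOne PlainDefectOne)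
open Summit.Schanuel.Schanuel.Theorems.RootDecomp1EAnchor (isAlgebraic_of_mem_adjoin
  trdeg_adjoin_le_of_isAlgebraic mem_adjoin_of_mem_span exp_isAlgebraic_of_mem_span isAlgebraic_transfer
  trdeg_adjoin_le_nat trdeg_le_of_mem_span exists_nat_eq_of_le_natCast span_range_le
  exists_basis_span_inf isAlgebraic_of_trdeg_sandwich isAlgebraic_of_le isAlgebraic_mul isAlgebraic_add)
open Summit.Schanuel.Schanuel.Theorems.RootDecomp1EModuleGrids (subMinimal_three rat_mul_pi_eq_rat)
open Summit.Schanuel.Schanuel.Theorems.RootDecomp1EModuleType (SubMinimalDefect)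
open Summit.Schanuel.Schanuel.Theorems.RootDecomp1EEngineType (LWRich PeriodRich EngineRich
  EngineRichDefectOneAt EngineDarkDefectOneAt FirstFailureLayer defectOne_iff_typeSplit defectOne_iff_layers
  trdeg_eq_nat le_trdeg_add_one_of_subMinimal two_le_trdeg_of_subMinimal trdeg_add_two_eq_of_firstFailure
  linearIndependent_comp_castLE two_le_trdeg_of_lwRich)
open Literature.NumberTheory.Transcendental (nesterenko nesterenko' algebraicIndependent_exp_holds
  transcendental_pi_holds transcendental_exp_holds)
open Literature.Barriers.Schanuel (WaldschmidtConjecture_2_3 gridField₂ LargeTranscendenceDegree)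

/-! ## §5 THE GRID CEILING: barrier B3 (several-variables method) against the layers of `S⁻`

A SPAN-GRID of `z : Fin n → ℂ` is a pair of ℚ-free families `x : Fin d → ℂ`, `y : Fin ℓ → ℂ` with all products
`xᵢyⱼ ∈ span_ℚ z` — the CERTIFIABLE entrance of `WaldschmidtConjecture_2_3` / `LargeTranscendenceDegree` (Diaz under
T.H.) / Theorem 2.9 into `F_z` (every literal grid member of rounds 7/9 is a span-grid; then `x, y, e^{xᵢyⱼ}` are, after
normalisation, algebraic over `F_z`, so `t ≤ t₁ ≤ t₂ ≤ trdeg F_z`).  We prove `d, ℓ ≤ n`, hence every output of the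
method ON A SPAN-GRID is `≤ ⌈n/2⌉`, which is `≤ n − 2` for `n ≥ 4` (proved side, even granting T.H.) and for `n ≥ 5`
(conjectural side, `[dℓ/(ℓ+d)] + 1`); at `n = 4` the conjectural `t₂`-output reaches `3 = n − 1` iff `d = ℓ = 4`, which
forces an irrational algebraic MULTIPLIER — so never on stmt-31410's class.  NOT COVERED (declared): grids in the
exponential module `{v : e^v ∈ F_z^{alg}} ⊋ span_ℚ z` (round 9/10's `ModuleRich`), whose sizes `d, ℓ` this numerology
does not bound — their existence at a first failure is itself transcendence-open (barrier B1; no certified instance). -/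

/-- Rows of a span-grid are at most the length: `x` ℚ-free, `y₀ ≠ 0`, `xᵢy₀ ∈ span_ℚ z` ⟹ `d ≤ n`. -/
theorem grid_rows_le {n d : ℕ} {z : Fin n → ℂ} {x : Fin d → ℂ} (hx : LinearIndependent ℚ x) {y₀ : ℂ}
    (hy₀ : y₀ ≠ 0) (hmem : ∀ i, x i * y₀ ∈ Submodule.span ℚ (Set.range z)) : d ≤ n := by
  have hli : LinearIndependent ℚ fun i => x i * y₀ := by
    have h := hx.map' (LinearMap.mulRight ℚ y₀)
      (LinearMap.ker_eq_bot.mpr fun a b hab => mul_left_injective₀ hy₀ (by simpa using hab))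
    exact h
  haveI : FiniteDimensional ℚ ↥(Submodule.span ℚ (Set.range z)) :=
    FiniteDimensional.span_of_finite ℚ (Set.finite_range _)
  have h1 : Module.finrank ℚ ↥(Submodule.span ℚ (Set.range fun i => x i * y₀)) = d := by
    simpa using finrank_span_eq_card hli
  have h2 := Submodule.finrank_mono (span_range_le hmem)
  have h3 : Module.finrank ℚ ↥(Submodule.span ℚ (Set.range z)) ≤ n :=
    (finrank_range_le_card _).trans (Fintype.card_fin _).le
  omega

/-- Columns likewise: `ℓ ≤ n`. -/
theorem grid_cols_le {n l : ℕ} {z : Fin n → ℂ} {y : Fin l → ℂ} (hy : LinearIndependent ℚ y) {x₀ : ℂ}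
    (hx₀ : x₀ ≠ 0) (hmem : ∀ j, x₀ * y j ∈ Submodule.span ℚ (Set.range z)) : l ≤ n :=
  grid_rows_le hy hx₀ (fun j => by rw [mul_comm]; exact hmem j)

/-- Numerology (t-clause): `2·[dℓ/(ℓ+d)] ≤ max(d, ℓ)`. -/
theorem two_mul_grid_t_le_max (d l : ℕ) : 2 * (d * l / (l + d)) ≤ max d l := by
  rcases Nat.eq_zero_or_pos (l + d) with h0 | hpos
  · have hd : d = 0 := by omega
    subst hd
    simp
  set k := d * l / (l + d) with hk_def
  have hk : k * (l + d) ≤ d * l := Nat.div_mul_le_self _ _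
  by_contra h
  push Not at h
  have hd : d + 1 ≤ 2 * k := by have := le_max_left d l; omega
  have hl : l + 1 ≤ 2 * k := by have := le_max_right d l; omega
  have h1 : (d + 1) * l ≤ 2 * k * l := Nat.mul_le_mul_right l hd
  have h2 : (l + 1) * d ≤ 2 * k * d := Nat.mul_le_mul_right d hl
  nlinarith

/-- Numerology (t₁-clause): `2·[d(ℓ+1)/(ℓ+d)] ≤ max(d, ℓ) + 1`. -/
theorem two_mul_grid_t₁_le_max (d l : ℕ) : 2 * (d * (l + 1) / (l + d)) ≤ max d l + 1 := by
  rcases Nat.eq_zero_or_pos l with hl0 | hlpos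
  · subst hl0
    rcases Nat.eq_zero_or_pos d with hd0 | hdpos
    · subst hd0; simp
    · have : d * (0 + 1) / (0 + d) = 1 := by simpa using Nat.div_self hdpos
      rw [this]; simp; omega
  set k := d * (l + 1) / (l + d) with hk_def
  have hk : k * (l + d) ≤ d * (l + 1) := Nat.div_mul_le_self _ _
  by_contra h
  push Not at h
  have hd : d + 2 ≤ 2 * k := by have := le_max_left d l; omega
  have hl : l + 2 ≤ 2 * k := by have := le_max_right d l; omega
  have h1 : (d + 2) * l ≤ 2 * k * l := Nat.mul_le_mul_right l hd
  have h2 : (l + 2) * d ≤ 2 * k * d := Nat.mul_le_mul_right d hl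
  nlinarith

/-- Numerology (T.H. t₂-clause, real ceiling): `dℓ/(ℓ+d) ≤ n/2` for `d, ℓ ≤ n`, hence `⌈dℓ/(ℓ+d)⌉ ≤ [(n+1)/2]`. -/
theorem grid_ceil_le {d l n : ℕ} (hd : d ≤ n) (hl : l ≤ n) :
    ⌈((d * l : ℕ) : ℚ) / ((l + d : ℕ) : ℚ)⌉₊ ≤ (n + 1) / 2 := by
  rw [Nat.ceil_le]
  rcases Nat.eq_zero_or_pos (l + d) with h0 | hpos
  · rw [h0]; simp
  have hq : ((d * l : ℕ) : ℚ) / ((l + d : ℕ) : ℚ) ≤ (n : ℚ) / 2 := by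
    rw [div_le_div_iff₀ (by exact_mod_cast hpos) (by norm_num)]
    have h : d * l * 2 ≤ n * (l + d) := by nlinarith
    exact_mod_cast h
  refine hq.trans ?_
  have h2 : n ≤ 2 * ((n + 1) / 2) := by omega
  have h2' : (n : ℚ) ≤ 2 * (((n + 1) / 2 : ℕ) : ℚ) := by exact_mod_cast h2
  linarith

/-- **SPAN-GRID CEILING, PROVED SIDE (B3 = Diaz under T.H.)**: on a span-grid of a tuple of length `n ≥ 4` (so
`d, ℓ ≤ n`) all three outputs `[dℓ/(ℓ+d)]`, `[d(ℓ+1)/(ℓ+d)]`, `⌈dℓ/(ℓ+d)⌉` of `LargeTranscendenceDegree` are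
`≤ n − 2` — the exact transcendence degree a first failure of length `n` already HAS (`trdeg_add_two_eq_of_firstFailure`):
on span-grids B3 is INERT at every length `n ≥ 4`, even granting the Technical Hypothesis. -/
theorem b3_outputs_le {d l n : ℕ} (hn : 4 ≤ n) (hd : d ≤ n) (hl : l ≤ n) :
    d * l / (l + d) ≤ n - 2 ∧ d * (l + 1) / (l + d) ≤ n - 2 ∧
      ⌈((d * l : ℕ) : ℚ) / ((l + d : ℕ) : ℚ)⌉₊ ≤ n - 2 := by
  have h1 := two_mul_grid_t_le_max d l
  have h2 := two_mul_grid_t₁_le_max d l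
  have h3 := grid_ceil_le hd hl
  have hmax : max d l ≤ n := max_le hd hl
  refine ⟨by omega, by omega, by omega⟩

/-- **SPAN-GRID CEILING, CONJECTURAL SIDE (`WaldschmidtConjecture_2_3`)**: for `n ≥ 5` all three conjectural
outputs, including `t₂ ≥ [dℓ/(ℓ+d)] + 1`, are `≤ n − 2`: on span-grids even B3's conjectural target is INERT from
length 5 on. -/
theorem conj23_outputs_le {d l n : ℕ} (hn : 5 ≤ n) (hd : d ≤ n) (hl : l ≤ n) :
    d * l / (l + d) ≤ n - 2 ∧ d * (l + 1) / (l + d) ≤ n - 2 ∧ d * l / (l + d) + 1 ≤ n - 2 := by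
  have h1 := two_mul_grid_t_le_max d l
  have h2 := two_mul_grid_t₁_le_max d l
  have hmax : max d l ≤ n := max_le hd hl
  refine ⟨by omega, by omega, by omega⟩

/-- At `n = 4` the conjectural `t₂`-output reaches `3 = n − 1` ONLY on the full `(4,4)` grid. -/
theorem conj23_t₂_eq_three_only_fullGrid {d l : ℕ} (hd : d ≤ 4) (hl : l ≤ 4) (h : 3 ≤ d * l / (l + d) + 1) :
    d = 4 ∧ l = 4 := by
  interval_cases d <;> interval_cases l <;> simp_all

/-- **MULTIPLIERS ARE ALGEBRAIC**: `γ·zᵢ ∈ span_ℚ z` for all `i` (`z` ℚ-free, `n ≥ 1`) ⟹ `γ ∈ ℚ̄` (`γ` stabilises a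
nonzero finitely generated ℚ-submodule of ℂ: `isIntegral_of_smul_mem_submodule`). -/
theorem isAlgebraic_of_multiplier {n : ℕ} {z : Fin n → ℂ} (hz : LinearIndependent ℚ z) (hn : 0 < n) {γ : ℂ}
    (hγ : ∀ i, γ * z i ∈ Submodule.span ℚ (Set.range z)) : IsAlgebraic ℚ γ := by
  have hN : Submodule.span ℚ (Set.range z) ≠ ⊥ := by
    intro h
    have hmem : z ⟨0, hn⟩ ∈ (⊥ : Submodule ℚ ℂ) := h ▸ Submodule.subset_span ⟨⟨0, hn⟩, rfl⟩
    exact hz.ne_zero ⟨0, hn⟩ ((Submodule.mem_bot ℚ).mp hmem)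
  have hx : ∀ v ∈ Submodule.span ℚ (Set.range z), γ • v ∈ Submodule.span ℚ (Set.range z) := by
    intro v hv
    refine Submodule.span_induction (fun w hw => ?_) (by simp) (fun a c _ _ ha hc => ?_) (fun q a _ ha => ?_) hv
    · obtain ⟨i, rfl⟩ := hw
      simpa using hγ i
    · simp only [smul_eq_mul, mul_add] at ha hc ⊢
      exact add_mem ha hc
    · rw [smul_eq_mul, mul_smul_comm]
      exact Submodule.smul_mem _ q (by simpa [smul_eq_mul] using ha)
  exact (isIntegral_of_smul_mem_submodule (Submodule.span ℚ (Set.range z)) hN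
    (Submodule.fg_span (Set.finite_range z)) γ hx).isAlgebraic

/-- **A FULL `(n,n)` SPAN-GRID FORCES AN IRRATIONAL ALGEBRAIC MULTIPLIER** (`n ≥ 2`): each column family `(xᵢyⱼ)ᵢ`
spans all of `V = span_ℚ z` (dimension count), so `V = yⱼ·X` for every `j` and `β = y₁/y₀` stabilises `V`; `β` is
algebraic (`isAlgebraic_of_multiplier`) and irrational (`y` is ℚ-free).  Hence `V` is E-STABLE, never plain. -/
theorem exists_irrational_multiplier_of_fullGrid {n : ℕ} {z : Fin n → ℂ} (hz : LinearIndependent ℚ z) (h2 : 2 ≤ n)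
    {x y : Fin n → ℂ} (hx : LinearIndependent ℚ x) (hy : LinearIndependent ℚ y)
    (hgrid : ∀ i j, x i * y j ∈ Submodule.span ℚ (Set.range z)) :
    ∃ β : ℂ, IsAlgebraic ℚ β ∧ β ∉ Set.range (algebraMap ℚ ℂ) ∧ ∀ i, β * z i ∈ Submodule.span ℚ (Set.range z) := by
  classical
  haveI : FiniteDimensional ℚ ↥(Submodule.span ℚ (Set.range z)) :=
    FiniteDimensional.span_of_finite ℚ (Set.finite_range _)
  haveI : FiniteDimensional ℚ ↥(Submodule.span ℚ (Set.range x)) :=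
    FiniteDimensional.span_of_finite ℚ (Set.finite_range _)
  have hVn : Module.finrank ℚ ↥(Submodule.span ℚ (Set.range z)) = n := by simpa using finrank_span_eq_card hz
  have hXn : Module.finrank ℚ ↥(Submodule.span ℚ (Set.range x)) = n := by simpa using finrank_span_eq_card hx
  have hn0 : 0 < n := by omega
  have hn1 : 1 < n := by omega
  have hyne : ∀ j, y j ≠ 0 := fun j => hy.ne_zero j
  -- every column family spans V:  `yⱼ·X = V`
  have hU : ∀ j, (Submodule.span ℚ (Set.range x)).map (LinearMap.mulRight ℚ (y j)) =
      Submodule.span ℚ (Set.range z) := by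
    intro j
    have hinj : Function.Injective (LinearMap.mulRight ℚ (y j)) :=
      fun a b hab => mul_left_injective₀ (hyne j) (by simpa using hab)
    have hle : (Submodule.span ℚ (Set.range x)).map (LinearMap.mulRight ℚ (y j)) ≤
        Submodule.span ℚ (Set.range z) := by
      rw [Submodule.map_le_iff_le_comap, Submodule.span_le]
      rintro _ ⟨i, rfl⟩
      simpa using hgrid i j
    refine Submodule.eq_of_le_of_finrank_le hle ?_
    rw [hVn, ← LinearEquiv.finrank_eq (Submodule.equivMapOfInjective _ hinj _), hXn]
  -- β = y₁ / y₀ stabilises V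
  have hβV : ∀ i, y ⟨1, hn1⟩ / y ⟨0, hn0⟩ * z i ∈ Submodule.span ℚ (Set.range z) := by
    intro i
    have hzi : z i ∈ (Submodule.span ℚ (Set.range x)).map (LinearMap.mulRight ℚ (y ⟨0, hn0⟩)) := by
      rw [hU]; exact Submodule.subset_span ⟨i, rfl⟩
    obtain ⟨u, hu, hzu⟩ := Submodule.mem_map.mp hzi
    simp only [LinearMap.mulRight_apply] at hzu
    have : y ⟨1, hn1⟩ / y ⟨0, hn0⟩ * z i = u * y ⟨1, hn1⟩ := by
      rw [← hzu]
      calc y ⟨1, hn1⟩ / y ⟨0, hn0⟩ * (u * y ⟨0, hn0⟩)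
          = u * y ⟨1, hn1⟩ * (y ⟨0, hn0⟩ / y ⟨0, hn0⟩) := by ring
        _ = u * y ⟨1, hn1⟩ := by rw [div_self (hyne _), mul_one]
    rw [this, ← hU ⟨1, hn1⟩]
    exact Submodule.mem_map_of_mem hu
  refine ⟨y ⟨1, hn1⟩ / y ⟨0, hn0⟩, isAlgebraic_of_multiplier hz hn0 hβV, ?_, hβV⟩
  rintro ⟨q, hq⟩
  have hq' : (q : ℂ) * y ⟨0, hn0⟩ = y ⟨1, hn1⟩ := (eq_div_iff (hyne _)).mp (by simpa using hq)
  have hk : (⟨0, hn0⟩ : Fin n) ≠ ⟨1, hn1⟩ := by simp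
  have hpair : LinearIndependent ℚ ![y ⟨0, hn0⟩, y ⟨1, hn1⟩] := by
    have := hy.comp ![(⟨0, hn0⟩ : Fin n), ⟨1, hn1⟩] (injective_pair hk)
    convert this using 1
    ext i; fin_cases i <;> rfl
  have hrel : (q : ℚ) • y ⟨0, hn0⟩ + (-1 : ℚ) • y ⟨1, hn1⟩ = 0 := by
    simp only [Rat.smul_def]
    rw [hq']
    push_cast
    ring
  have := (LinearIndependent.pair_iff.mp hpair q (-1) hrel).2
  norm_num at this

/-- **NO FULL GRID ON A PLAIN SPAN** (the multiplication-type hypothesis of stmt-31410 excludes every `(n,n)` span-grid). -/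
theorem no_fullGrid_of_plain {n : ℕ} {z : Fin n → ℂ} (hz : LinearIndependent ℚ z) (h2 : 2 ≤ n)
    (hplain : ∀ β : ℂ, IsAlgebraic ℚ β → (∀ i, β * z i ∈ Submodule.span ℚ (Set.range z)) →
      β ∈ Set.range (algebraMap ℚ ℂ))
    {x y : Fin n → ℂ} (hx : LinearIndependent ℚ x) (hy : LinearIndependent ℚ y) :
    ¬ ∀ i j, x i * y j ∈ Submodule.span ℚ (Set.range z) := fun hgrid => by
  obtain ⟨β, hβalg, hβirr, hβV⟩ := exists_irrational_multiplier_of_fullGrid hz h2 hx hy hgrid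
  exact hβirr (hplain β hβalg hβV)

/-- **CONJECTURE 2.3 IS INERT ON stmt-31410's LAYER 4**: every span-grid (`d, ℓ ≥ 1`) of a PLAIN ℚ-free quadruple has
conjectural `t₂`-output `[dℓ/(ℓ+d)] + 1 ≤ 2 = n − 2`.  (With `b3_outputs_le`: the whole several-variables family,
proved or conjectural, is silent on the residual's first open layer.) -/
theorem conj23_inert_on_plain_four {z : Fin 4 → ℂ} (hz : LinearIndependent ℚ z)
    (hplain : ∀ β : ℂ, IsAlgebraic ℚ β → (∀ i, β * z i ∈ Submodule.span ℚ (Set.range z)) →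
      β ∈ Set.range (algebraMap ℚ ℂ))
    {d l : ℕ} {x : Fin d → ℂ} {y : Fin l → ℂ} (hx : LinearIndependent ℚ x) (hy : LinearIndependent ℚ y)
    (hd : 0 < d) (hl : 0 < l) (hgrid : ∀ i j, x i * y j ∈ Submodule.span ℚ (Set.range z)) :
    d * l / (l + d) + 1 ≤ 2 := by
  have hd4 : d ≤ 4 := grid_rows_le hx (hy.ne_zero ⟨0, hl⟩) (fun i => hgrid i ⟨0, hl⟩)
  have hl4 : l ≤ 4 := grid_cols_le hy (hx.ne_zero ⟨0, hd⟩) (fun j => hgrid ⟨0, hd⟩ j)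
  by_contra h
  push Not at h
  obtain ⟨rfl, rfl⟩ := conj23_t₂_eq_three_only_fullGrid hd4 hl4 (by omega)
  exact no_fullGrid_of_plain hz (by norm_num) hplain hx hy hgrid

/-- FULL-GRID quadruples (the E-stable side: `V` is a line over a quartic number field, e.g. `π·(1, i, √2, i√2)`). -/
def FullGridFour (z : Fin 4 → ℂ) : Prop :=
  ∃ x y : Fin 4 → ℂ, LinearIndependent ℚ x ∧ LinearIndependent ℚ y ∧ ∀ i j, x i * y j ∈ Submodule.span ℚ (Set.range z)

/-- **CONDITIONAL DECIDED CELL: `WaldschmidtConjecture_2_3 ⟹ S⁻` on the full-grid quadruples** — the ONLY place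
where B3's conjectural ceiling touches a layer `n ≥ 4`.  (Normalise the grid to `x'ᵢ = xᵢy₀ ∈ V`, `y'ⱼ = yⱼ/y₀`, an
algebraic multiplier; then `x', y', e^{x'ᵢy'ⱼ}` are algebraic over `F_z` and `t₂ ≥ [16/8] + 1 = 3`.) -/
theorem defectOne_fullGridFour_of_conj23 (hW : WaldschmidtConjecture_2_3) (z : Fin 4 → ℂ)
    (hz : LinearIndependent ℚ z) (hg : FullGridFour z) :
    ((4 : ℕ) : Cardinal) ≤ Algebra.trdeg ℚ ↥(adjoin ℚ (Set.range z ∪ Set.range (cexp ∘ z))) + 1 := by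
  classical
  obtain ⟨x, y, hx, hy, hgrid⟩ := hg
  set V : Submodule ℚ ℂ := Submodule.span ℚ (Set.range z) with hV
  set X : Submodule ℚ ℂ := Submodule.span ℚ (Set.range x) with hX
  haveI : FiniteDimensional ℚ ↥V := FiniteDimensional.span_of_finite ℚ (Set.finite_range _)
  haveI : FiniteDimensional ℚ ↥X := FiniteDimensional.span_of_finite ℚ (Set.finite_range _)
  have hVn : Module.finrank ℚ ↥V = 4 := by simpa using finrank_span_eq_card hz
  have hXn : Module.finrank ℚ ↥X = 4 := by simpa using finrank_span_eq_card hx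
  have hyne : ∀ j, y j ≠ 0 := fun j => hy.ne_zero j
  have hU : ∀ j, X.map (LinearMap.mulRight ℚ (y j)) = V := by
    intro j
    have hinj : Function.Injective (LinearMap.mulRight ℚ (y j)) :=
      fun a b hab => mul_left_injective₀ (hyne j) (by simpa using hab)
    have hle : X.map (LinearMap.mulRight ℚ (y j)) ≤ V := by
      rw [Submodule.map_le_iff_le_comap, hX, Submodule.span_le]
      rintro _ ⟨i, rfl⟩
      simpa using hgrid i j
    refine Submodule.eq_of_le_of_finrank_le hle ?_
    rw [hVn, ← LinearEquiv.finrank_eq (Submodule.equivMapOfInjective _ hinj X), hXn]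
  -- normalised grid
  let x' : Fin 4 → ℂ := fun i => x i * y 0
  let y' : Fin 4 → ℂ := fun j => y j * (y 0)⁻¹
  have hx'li : LinearIndependent ℚ x' :=
    hx.map' (LinearMap.mulRight ℚ (y 0))
      (LinearMap.ker_eq_bot.mpr fun a b hab => mul_left_injective₀ (hyne 0) (by simpa using hab))
  have hy'li : LinearIndependent ℚ y' :=
    hy.map' (LinearMap.mulRight ℚ (y 0)⁻¹)
      (LinearMap.ker_eq_bot.mpr fun a b hab => mul_left_injective₀ (inv_ne_zero (hyne 0)) (by simpa using hab))
  have hx'V : ∀ i, x' i ∈ V := fun i => hgrid i 0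
  -- `y'ⱼ` is a multiplier of `V`, hence algebraic
  have hy'mul : ∀ j i, y' j * z i ∈ V := by
    intro j i
    have hzi : z i ∈ X.map (LinearMap.mulRight ℚ (y 0)) := by
      rw [hU 0]; exact Submodule.subset_span ⟨i, rfl⟩
    obtain ⟨u, hu, hzu⟩ := Submodule.mem_map.mp hzi
    simp only [LinearMap.mulRight_apply] at hzu
    have : y' j * z i = u * y j := by
      rw [← hzu]
      calc y j * (y 0)⁻¹ * (u * y 0) = u * y j * ((y 0)⁻¹ * y 0) := by ring
        _ = u * y j := by rw [inv_mul_cancel₀ (hyne 0), mul_one]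
    rw [this, ← hU j]
    exact Submodule.mem_map_of_mem hu
  have hy'alg : ∀ j, IsAlgebraic ℚ (y' j) := fun j => isAlgebraic_of_multiplier hz (by norm_num) (hy'mul j)
  have hprod : ∀ i j, x' i * y' j = x i * y j := by
    intro i j
    calc x i * y 0 * (y j * (y 0)⁻¹) = x i * y j * (y 0 * (y 0)⁻¹) := by ring
      _ = x i * y j := by rw [mul_inv_cancel₀ (hyne 0), mul_one]
  -- Conjecture 2.3 at the normalised (4,4) grid
  obtain ⟨-, -, h3⟩ := hW 4 4 x' y' hx'li hy'li (by norm_num) (by norm_num)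
  have h3' : ((3 : ℕ) : Cardinal) ≤ Algebra.trdeg ℚ ↥(gridField₂ x' y') := by
    have : (4 * 4 / (4 + 4) + 1 : ℕ) = 3 := by norm_num
    simpa [this] using h3
  -- all generators of `gridField₂ x' y'` are algebraic over `F_z`
  have hgen : ∀ w ∈ Set.range x' ∪ Set.range y' ∪ Set.range (fun p : Fin 4 × Fin 4 => cexp (x' p.1 * y' p.2)),
      IsAlgebraic ↥(adjoin ℚ (Set.range z ∪ Set.range (cexp ∘ z))) w := by
    rintro w ((⟨i, rfl⟩ | ⟨j, rfl⟩) | ⟨p, rfl⟩)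
    · exact isAlgebraic_of_mem_adjoin (mem_adjoin_of_mem_span (hx'V i))
    · exact (hy'alg j).tower_top _
    · show IsAlgebraic _ (cexp (x' p.1 * y' p.2))
      rw [hprod]
      exact exp_isAlgebraic_of_mem_span (hgrid p.1 p.2)
  have hle : Algebra.trdeg ℚ ↥(gridField₂ x' y') ≤ Algebra.trdeg ℚ ↥(adjoin ℚ (Set.range z ∪ Set.range (cexp ∘ z))) :=
    trdeg_adjoin_le_of_isAlgebraic hgen
  calc ((4 : ℕ) : Cardinal) = ((3 : ℕ) : Cardinal) + 1 := by push_cast; norm_num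
    _ ≤ Algebra.trdeg ℚ ↥(adjoin ℚ (Set.range z ∪ Set.range (cexp ∘ z))) + 1 := add_le_add (h3'.trans hle) le_rfl

end Summit.Schanuel.Schanuel.Theorems.RootDecomp1ELevels

end
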